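import Literature.AlgebraicGeometry.Frobenioids.BaseSectionsOfObjectsCor57bProofs
import Literature.AlgebraicGeometry.Frobenioids.EquivalencePreStepsFSMFF2008Assembly
import Literature.AlgebraicGeometry.Frobenioids.Cor411iiOfThm34ii
import HarnessLib

/-!
# Frobenioids I, Corollary 5.7 (iii), (iv) — the named facts `PreFrobenioid.Cor57iii`, `PreFrobenioid.Cor57iv`
# HOLD (universal closures, 2008 wording, no hypothesis on the bases beyond print's)

Mochizuki, *The geometry of Frobenioids I: the general theory*, Kyushu J. Math. **62** (2008)
293–400, Cor. 5.7 (iii), (iv) p. 108, proof p. 108 ll. 15–21: "sorting through the definitions, to verify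
assertions (i), (ii), (iii), (iv) it suffices to show that `Ψ` preserves isotropic objects, prime-Frobenius
morphisms, pull-back morphisms, birationalizations, the natural projection functor `C_i → D_i` …, and …
Frobenius degrees. But this follows from Theorem 3.4, (i), (iii); Corollary 4.10; Corollary 4.11, (ii)."
[cite: MochizukiFrdI2008, Cor. 5.7 (iii) p.108] [cite: MochizukiFrdI2008, Cor. 5.7 (iv) p.108]

PROOF-ONLY companion of `BaseSectionsOfObjects.lean` (statements, seat abc-iut-L1-t5), abc-iut cell, seat
abc-iut-f-023, FACT-LIST rows F-0939 `Cor57iii`, F-0940 `Cor57iv` — the (iii)/(iv) sequel (as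
`BaseSectionsOfObjectsCor57bProofs.lean` is to `BaseSectionsOfObjectsCor57Proofs.lean`) of seat abc-iut-f-022's
`BaseSectionsOfObjectsCor57Holds.lean` (Cor. 5.7 (i), (ii): F-0936 – F-0938); the two files are independent and
declare no common name. abc-iut-L1-d6's `cor57iii_of` / `cor57iv_of` (`BaseSectionsOfObjectsCor57bProofs.lean`)
prove the typed statements modulo the typed PER-INSTANCE [FrdI] Thm. 3.4 (ii) (for `Ψ`, `Ψ⁻¹`), Thm. 3.4 (iii)
and Cor. 4.11 (ii) for `Ψ`. All three are now theorems of the tree in PRINT'S GENERALITY (2008 wording of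
"FSMFF-type", entering through standard type (d)):

* Thm. 3.4 (ii), (iii): the 0-ary named facts `FrdI.Thm34ii`, `FrdI.Thm34iii` HOLD — `FrdI.Thm34ii_holds`,
  `FrdI.Thm34iii_holds` (seat abc-iut-L1-t11 over seat abc-iut-L1-t13's core,
  `EquivalencePreStepsFSMFF2008Assembly.lean`), instantiated at `(F₁, F₂, Ψ)` and `(F₂, F₁, Ψ⁻¹)`;
* Cor. 4.11 (ii): seat abc-iut-L1-d6's `cor411ii_ofFunctor_of_thm34ii` (`Cor411iiOfThm34ii.lean`) — the typed
  per-instance `Cor411ii` for `Ψ` from the typed per-instance Thm. 3.4 (ii) for `Ψ`, `Ψ⁻¹`, for Frobenioids with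
  `Φ_i` perf-factorial (both supplied by the standing hypotheses `Cor57Hypotheses` of Cor. 5.7); fed with the
  two instances of `FrdI.Thm34ii_holds` — the same term that closes the 0-ary `FrdI.Cor411ii` (FACT-LIST F-0715,
  filed by its claimant seat abc-iut-f-037 as `FrdI.Cor411ii_holds`) and that seat abc-iut-f-022 names
  `Cor57Hypotheses.cor411ii`; it is inlined here so that this file depends on neither.

Hence the universal closures of the typed Cor. 5.7 (iii), (iv) hold outright: for EVERY pair of Frobenioids
`C_i → F_{Φ_i}`, every equivalence `Ψ : C₁ ⥲ C₂` and all birationalization data `B₁`, `B₂` (the statements are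
SCHEMAS in `B_i`, which enter only the model-type antecedents; neither the model-type nor the unit-profinite
antecedent is used by the proof — cf. the author's *Comments* (2024), item (2): "the hypothesis … of
'unit-profinite type' in Proposition 5.6 — hence also in Corollary 5.7, (iii) — may be removed"), under exactly
the printed hypotheses `Cor57Hypotheses` (perf-factorial, Div-slim, standard type, base-isomorphisms in the
group-like case). The closing theorems state their FULLY-QUALIFIED types.

Nothing here is specific to the abc programme; no statement of the paper is restated or strengthened; no new
definition; nothing bears on, or takes a side on, [IUTchIII] Cor. 3.12.
-/

namespace Literature.AlgebraicGeometry.Frobenioids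

open CategoryTheory Opposite

universe w v v' u u'

namespace PreFrobenioid

section Cor57bHolds

variable {D₁ : Type u} [Category.{v} D₁] {Φ₁ : D₁ᵒᵖ ⥤ CommMonCat.{w}}
  {C₁ : Type u'} [Category.{v'} C₁] (F₁ : C₁ ⥤ ElemFrobenioid Φ₁)
  {D₂ : Type u} [Category.{v} D₂] {Φ₂ : D₂ᵒᵖ ⥤ CommMonCat.{w}}
  {C₂ : Type u'} [Category.{v'} C₂] (F₂ : C₂ ⥤ ElemFrobenioid Φ₂) (Ψ : C₁ ≌ C₂)

/-- **The named fact [FrdI] Corollary 5.7 (iii) (`PreFrobenioid.Cor57iii`, FACT-LIST row F-0939) HOLDS**: for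
`C₁`, `C₂` of model and unit-profinite type, "`Ψ` maps every quasi-base-Frobenius pair of a Frobenius-trivial
object `A₁ ∈ Ob(C₁)` to a quasi-base-Frobenius pair of a Frobenius-trivial object `A₂ ∈ Ob(C₂)`" — the typed
statement, for every `F₁`, `F₂`, `Ψ`, `B₁`, `B₂`: abc-iut-L1-d6's `cor57iii_of` with its Thm. 3.4 (iii) input
the instance of `FrdI.Thm34iii_holds` and its Cor. 4.11 (ii) input `cor411ii_ofFunctor_of_thm34ii` at the two
instances of `FrdI.Thm34ii_holds` ("Theorem 3.4, (iii); … Corollary 4.11, (ii)", p. 108 l. 21). FULLY-QUALIFIED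
type. [cite: MochizukiFrdI2008, Cor. 5.7 (iii) p.108] -/
theorem cor57iii_holds (B₁ : (PreFrobenioidData.ofFunctor Φ₁ F₁).BiratData)
    (B₂ : (PreFrobenioidData.ofFunctor Φ₂ F₂).BiratData) :
    Literature.AlgebraicGeometry.Frobenioids.PreFrobenioid.Cor57iii F₁ F₂ Ψ B₁ B₂ := fun hyp =>
  cor57iii_of F₁ F₂ Ψ B₁ B₂ (FrdI.Thm34iii_holds F₁ F₂ hyp.isFrobenioid₁ hyp.isFrobenioid₂ Ψ)
    (cor411ii_ofFunctor_of_thm34ii hyp.isFrobenioid₁ hyp.isFrobenioid₂ Ψ hyp.perfFactorial₁ hyp.perfFactorial₂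
      (FrdI.Thm34ii_holds F₁ F₂ hyp.isFrobenioid₁ hyp.isFrobenioid₂ Ψ)
      (FrdI.Thm34ii_holds F₂ F₁ hyp.isFrobenioid₂ hyp.isFrobenioid₁ Ψ.symm))
    hyp

/-- **The named fact [FrdI] Corollary 5.7 (iv) (`PreFrobenioid.Cor57iv`, FACT-LIST row F-0940) HOLDS**:
"Suppose, moreover, when `C₁`, `C₂` are of group-like type, that both `Ψ` and some quasi-inverse to `Ψ`
preserve Frobenius degrees. Then the prefix 'quasi-' may be removed from the statements of (i), (iii)" — the
typed statement, for every `F₁`, `F₂`, `Ψ`, `B₁`, `B₂`: abc-iut-L1-d6's `cor57iv_of` with its Thm. 3.4 (ii)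
inputs (`Ψ`, `Ψ⁻¹`: removal of "quasi-" via `Ψ^{N_{≥1}} = id`) the two instances of `FrdI.Thm34ii_holds`, its
Thm. 3.4 (iii) input the instance of `FrdI.Thm34iii_holds`, and its Cor. 4.11 (ii) input as in `cor57iii_holds`.
FULLY-QUALIFIED type. [cite: MochizukiFrdI2008, Cor. 5.7 (iv) p.108] -/
theorem cor57iv_holds (B₁ : (PreFrobenioidData.ofFunctor Φ₁ F₁).BiratData)
    (B₂ : (PreFrobenioidData.ofFunctor Φ₂ F₂).BiratData) :
    Literature.AlgebraicGeometry.Frobenioids.PreFrobenioid.Cor57iv F₁ F₂ Ψ B₁ B₂ := fun hyp =>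
  cor57iv_of F₁ F₂ Ψ B₁ B₂ (FrdI.Thm34ii_holds F₁ F₂ hyp.isFrobenioid₁ hyp.isFrobenioid₂ Ψ)
    (FrdI.Thm34ii_holds F₂ F₁ hyp.isFrobenioid₂ hyp.isFrobenioid₁ Ψ.symm)
    (FrdI.Thm34iii_holds F₁ F₂ hyp.isFrobenioid₁ hyp.isFrobenioid₂ Ψ)
    (cor411ii_ofFunctor_of_thm34ii hyp.isFrobenioid₁ hyp.isFrobenioid₂ Ψ hyp.perfFactorial₁ hyp.perfFactorial₂
      (FrdI.Thm34ii_holds F₁ F₂ hyp.isFrobenioid₁ hyp.isFrobenioid₂ Ψ)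
      (FrdI.Thm34ii_holds F₂ F₁ hyp.isFrobenioid₂ hyp.isFrobenioid₁ Ψ.symm))
    hyp

end Cor57bHolds

/-! ### Exact-name closed witnesses (FACT-LIST rows F-0939, F-0940; fully-qualified universal closures) -/

/-- FACT-LIST F-0939: [FrdI] Cor. 5.7 (iii); exact-name CLOSED witness of the universal closure of
`PreFrobenioid.Cor57iii` over all its binders (proof = `cor57iii_holds`). [cite: MochizukiFrdI2008, Cor. 5.7 (iii) p.108] -/
theorem Cor57iii_holds :
    ∀ {D₁ : Type u} [Category.{v} D₁] {Φ₁ : D₁ᵒᵖ ⥤ CommMonCat.{w}} {C₁ : Type u'} [Category.{v'} C₁]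
      (F₁ : C₁ ⥤ ElemFrobenioid Φ₁)
      {D₂ : Type u} [Category.{v} D₂] {Φ₂ : D₂ᵒᵖ ⥤ CommMonCat.{w}} {C₂ : Type u'} [Category.{v'} C₂]
      (F₂ : C₂ ⥤ ElemFrobenioid Φ₂) (Ψ : C₁ ≌ C₂) (B₁ : (PreFrobenioidData.ofFunctor Φ₁ F₁).BiratData)
      (B₂ : (PreFrobenioidData.ofFunctor Φ₂ F₂).BiratData),
      Literature.AlgebraicGeometry.Frobenioids.PreFrobenioid.Cor57iii F₁ F₂ Ψ B₁ B₂ :=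
  @cor57iii_holds

/-- FACT-LIST F-0940: [FrdI] Cor. 5.7 (iv); exact-name CLOSED witness of the universal closure of
`PreFrobenioid.Cor57iv` over all its binders (proof = `cor57iv_holds`). [cite: MochizukiFrdI2008, Cor. 5.7 (iv) p.108] -/
theorem Cor57iv_holds :
    ∀ {D₁ : Type u} [Category.{v} D₁] {Φ₁ : D₁ᵒᵖ ⥤ CommMonCat.{w}} {C₁ : Type u'} [Category.{v'} C₁]
      (F₁ : C₁ ⥤ ElemFrobenioid Φ₁)
      {D₂ : Type u} [Category.{v} D₂] {Φ₂ : D₂ᵒᵖ ⥤ CommMonCat.{w}} {C₂ : Type u'} [Category.{v'} C₂]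
      (F₂ : C₂ ⥤ ElemFrobenioid Φ₂) (Ψ : C₁ ≌ C₂) (B₁ : (PreFrobenioidData.ofFunctor Φ₁ F₁).BiratData)
      (B₂ : (PreFrobenioidData.ofFunctor Φ₂ F₂).BiratData),
      Literature.AlgebraicGeometry.Frobenioids.PreFrobenioid.Cor57iv F₁ F₂ Ψ B₁ B₂ :=
  @cor57iv_holds

end PreFrobenioid

end Literature.AlgebraicGeometry.Frobenioids
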